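import Summits.CriticalPhenomena.PercolationContinuityZ3.Theorems.PercNearOneGluingNoHeavyLowerTailSahiCTCHarrisUp
import Summits.CriticalPhenomena.PercolationContinuityZ3.Theorems.PercNearOneGluingNoHeavyLowerTailSahiCTCSignature
import HarnessLib

/-!
# `NoHeavyLowerTail` (crux stmt-CriticalPhenomena-4575), P3 lane: LUMPED FORMS — the R form and the small-world form for an ARBITRARY lumped family `D`,
# the structure identity `R_D = GF(D)·H + Π·N_D`, and the ONE-VERTEX-MONOTONICITY REDUCTION (C1 ∧ C2 ⇒ `R_D ∈ ℕ[s]`) of memo g27 §4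

Support file (seat `prim-l12-p3`, gen 28; `--supports stmt-CriticalPhenomena-4575`).  Memos `run/shared/lean/prim/prim-l12/FROM-prim-l12-p3-g27-RT-MONOTONICITY.md` §4
and `…-g28-TRANSFER-PRINCIPLE.md` §1–§2.  For a family `D ⊆ 2^α` (the "lumped set"; `D = {S : #S < t}` gives the level-`t` forms `R_t`, `N_t` of `…SahiCTCRtForm`)
and families `𝒳, 𝒵`:
* `Rlump D 𝒳 𝒵 = GF(D)·(Π·GF((𝒳∩𝒵)∖D) − GF(𝒳)GF(𝒵)) + Π·GF(𝒳∩D)·GF(𝒵∩D)`,  `Nlump D 𝒳 𝒵 = GF(𝒳∩D)·GF(𝒵∩D) − GF(D)·GF(𝒳∩𝒵∩D)`;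
* `Rlump_eq_harris_add_Nlump` : **`R_D = GF(D)·(Π·GF(𝒳∩𝒵) − GF(𝒳)GF(𝒵)) + Π·N_D`**, hence `coeff_Rlump_nonneg_of_Nlump` (up-sets; Harris block `…SahiCTCHarrisUp`);
* `Rlump_threshold_eq` : the threshold case written out (it is `…SahiCTCRtForm.Rt t` verbatim);
* `coeff_gf3_of_pure`, `coeff_Rlump_eq_zero_of_pure` : at a profile with all entries in `{0} ∪ [3,∞)` every `R_D` coefficient vanishes;
* `coeff_nonneg_of_oneVertex_monotone` : a function on profiles that vanishes at such profiles and is monotone under `1 → 0` and `2 → 3` at single vertices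
  is `≥ 0` everywhere (induction on the number of entries in `{1,2}`);
* **`coeff_Rlump_nonneg_of_C1_C2`** : memo g27 §4.1 — the one-vertex monotonicities C1 (`c(m) ≥ c(m − e_v)` when `m_v = 1`) and C2 (`c(m) ≥ c(m + e_v)` when
  `m_v = 2`) of the coefficients of `R_D(𝒳,𝒵)` imply `R_D(𝒳,𝒵) ∈ ℕ[s]` (any `D`, any pair).
The transfer principle of memo g28 (N_D ≥ 0 on disjoint-support pairs ⇒ R_D ≥ 0 on all pairs; verified n ≤ 5) is NOT asserted.  Nothing is asserted about the crux.
-/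

noncomputable section

open scoped Classical

namespace Summit.CriticalPhenomena.PercolationContinuityZ3.Theorems.SahiCTCForms

open Finset MvPolynomial SahiCTCGenFun

variable {α : Type*} [DecidableEq α] [Fintype α]

/-! ### The lumped forms -/

/-- **The R form of a lumped family `D`**: `GF(D)·(Π·GF((𝒳∩𝒵)∖D) − GF(𝒳)GF(𝒵)) + Π·GF(𝒳∩D)·GF(𝒵∩D)`. [this work] -/
def Rlump (D F G : Finset (Finset α)) : MvPolynomial α ℤ :=
  gf D * (PiP * gf ((F ∩ G).filter fun S => S ∉ D) - gf F * gf G) + PiP * (gf (F.filter fun S => S ∈ D) * gf (G.filter fun S => S ∈ D))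

/-- **The small-world form of a lumped family `D`**: `GF(𝒳∩D)·GF(𝒵∩D) − GF(D)·GF(𝒳∩𝒵∩D)`. [this work] -/
def Nlump (D F G : Finset (Finset α)) : MvPolynomial α ℤ :=
  gf (F.filter fun S => S ∈ D) * gf (G.filter fun S => S ∈ D) - gf D * gf ((F ∩ G).filter fun S => S ∈ D)

omit [Fintype α] in
/-- A family splits into its members inside and outside `D`. [this work] -/
theorem gf_eq_filter_mem_add_filter_not_mem (D F : Finset (Finset α)) :
    gf F = gf (F.filter fun S => S ∈ D) + gf (F.filter fun S => S ∉ D) := by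
  rw [← gf_union (disjoint_filter_filter_not F F fun S => S ∈ D), filter_union_filter_not_eq]

/-- **Structure identity**: `R_D = GF(D)·(Π·GF(𝒳∩𝒵) − GF(𝒳)GF(𝒵)) + Π·N_D`. [this work] -/
theorem Rlump_eq_harris_add_Nlump (D F G : Finset (Finset α)) :
    Rlump D F G = gf D * (PiP * gf (F ∩ G) - gf F * gf G) + PiP * Nlump D F G := by
  unfold Rlump Nlump
  rw [gf_eq_filter_mem_add_filter_not_mem D (F ∩ G)]
  ring

/-- **`R_D ∈ ℕ[s]` whenever `N_D ∈ ℕ[s]`** (up-sets `𝒳, 𝒵`; the Harris block pays the rest). [this work] -/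
theorem coeff_Rlump_nonneg_of_Nlump {D F G : Finset (Finset α)} (hF : IsUpperSet (F : Set (Finset α)))
    (hG : IsUpperSet (G : Set (Finset α))) (hN : ∀ m, 0 ≤ (Nlump D F G).coeff m) (n : α →₀ ℕ) : 0 ≤ (Rlump D F G).coeff n := by
  rw [Rlump_eq_harris_add_Nlump, coeff_add]
  refine add_nonneg (coeff_mul_nonneg (coeff_gf_nonneg _) (coeff_harris_up_sub_nonneg hF hG) n) ?_
  unfold PiP; exact coeff_mul_nonneg (coeff_gf_nonneg _) hN n

/-- **No common members in `D` ⇒ `R_D ∈ ℕ[s]`** (then `N_D = GF(𝒳∩D)·GF(𝒵∩D)`). [this work] -/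
theorem coeff_Rlump_nonneg_of_inter_filter_eq_empty {D F G : Finset (Finset α)} (hF : IsUpperSet (F : Set (Finset α)))
    (hG : IsUpperSet (G : Set (Finset α))) (h0 : ((F ∩ G).filter fun S => S ∈ D) = ∅) (n : α →₀ ℕ) : 0 ≤ (Rlump D F G).coeff n := by
  refine coeff_Rlump_nonneg_of_Nlump hF hG (fun m => ?_) n
  unfold Nlump
  rw [h0]
  unfold gf
  rw [sum_empty, mul_zero, sub_zero]
  exact coeff_mul_nonneg (coeff_gf_nonneg _) (coeff_gf_nonneg _) m

/-- **The threshold case written out**: with `D = {S : #S < t}` the lumped R form is the polynomial `R_t` of the level-`t` programme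
(`Θ_{t−1}·(Π·Y_{≥t} − X·Z) + Π·X_{<t}·Z_{<t}`; literally `…SahiCTCRtForm.Rt t`). [this work] -/
theorem Rlump_threshold_eq (t : ℕ) (F G : Finset (Finset α)) :
    Rlump (univ.powerset.filter fun S : Finset α => #S < t) F G =
      gf (univ.powerset.filter fun S : Finset α => #S < t) * (PiP * gf ((F ∩ G).filter fun S => t ≤ #S) - gf F * gf G)
        + PiP * (gf (F.filter fun S => #S < t) * gf (G.filter fun S => #S < t)) := by
  have h1 : ((F ∩ G).filter fun S => S ∉ univ.powerset.filter fun S : Finset α => #S < t) = (F ∩ G).filter fun S => t ≤ #S := by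
    refine filter_congr fun S _ => ?_
    simp only [mem_filter, mem_powerset, subset_univ, true_and, not_lt]
  have h2 : ∀ K : Finset (Finset α), (K.filter fun S => S ∈ univ.powerset.filter fun S : Finset α => #S < t) = K.filter fun S => #S < t :=
    fun K => filter_congr fun S _ => by simp only [mem_filter, mem_powerset, subset_univ, true_and]
  unfold Rlump
  rw [h1, h2, h2]

/-! ### Pure profiles carry no coefficient -/

/-- At a profile `m` all of whose entries lie in `{0} ∪ [3,∞)`, the coefficient of a product of three generating functions is `1` if `m = 3·1_T` with `T`
in all three families (`T = supp m`), and `0` otherwise. [this work] -/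
theorem coeff_gf3_of_pure (A B C : Finset (Finset α)) {m : α →₀ ℕ} (hm : ∀ v, m v = 0 ∨ 3 ≤ m v) :
    (gf A * (gf B * gf C)).coeff m =
      if (∀ v, m v = 0 ∨ m v = 3) ∧ m.support ∈ A ∧ m.support ∈ B ∧ m.support ∈ C then 1 else 0 := by
  set T := m.support with hT
  rw [coeff_gf_mul]
  -- only `S = T` can contribute, and only when `m = 3·1_T`
  have hvan : ∀ S ∈ A.filter (fun S => ind S ≤ m), S ≠ T ∨ ¬ (∀ v, m v = 0 ∨ m v = 3) → (gf B * gf C).coeff (m - ind S) = 0 := by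
    intro S hS h
    rw [coeff_gf_mul_gf, filter_prod_eq_empty, card_empty, Nat.cast_zero]
    intro hle
    have hSm : S ⊆ T := (SahiAllButC.ind_le_iff_subset_support S m).1 (mem_filter.1 hS).2
    -- every `v ∈ T` has `m v ≥ 3`, so `(m - ind S) v ≤ 2` forces `v ∈ S` and `m v = 3`
    have key : ∀ v ∈ T, v ∈ S ∧ m v = 3 := fun v hv => by
      have h1 := hle v
      rw [SahiAllButC.tsub_ind_apply] at h1
      have h2 : m v ≠ 0 := Finsupp.mem_support_iff.1 hv
      rcases hm v with h3 | h3
      · exact absurd h3 h2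
      · by_cases hvS : v ∈ S
        · rw [if_pos hvS] at h1; exact ⟨hvS, by omega⟩
        · rw [if_neg hvS] at h1; omega
    rcases h with h | h
    · exact h (Subset.antisymm hSm fun v hv => (key v hv).1)
    · exact h fun v => by
        by_cases hv : v ∈ T
        · exact Or.inr (key v hv).2
        · exact Or.inl (Finsupp.notMem_support_iff.1 hv)
  by_cases hpure : ∀ v, m v = 0 ∨ m v = 3
  · by_cases hTA : T ∈ A
    · -- the term `S = T`
      have hTle : ind T ≤ m := (SahiAllButC.ind_le_iff_subset_support T m).2 Subset.rfl
      have hTf : T ∈ A.filter fun S => ind S ≤ m := mem_filter.2 ⟨hTA, hTle⟩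
      rw [← add_sum_erase _ _ hTf, sum_eq_zero (fun S hS => hvan S (mem_of_mem_erase hS) (Or.inl (ne_of_mem_erase hS))), add_zero]
      -- residual profile `m - 1_T` is `2·1_T`: pairs `(Q,R)` with `1_Q + 1_R = m - 1_T` are exactly `(T,T)`
      have hres : ∀ v, (m - ind T) v = if v ∈ T then 2 else 0 := fun v => by
        rw [SahiAllButC.tsub_ind_apply]
        by_cases hv : v ∈ T
        · rw [if_pos hv, if_pos hv]; have := Finsupp.mem_support_iff.1 hv; rcases hpure v with h | h <;> omega
        · rw [if_neg hv, if_neg hv, Finsupp.notMem_support_iff.1 hv]; rfl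
      have hdbl : dbl (m - ind T) = T := by
        ext v; simp only [dbl, mem_filter, Finsupp.mem_support_iff, hres]; split_ifs with h <;> simp [h]
      have hsupp : (m - ind T).support = T := by
        ext v; simp only [Finsupp.mem_support_iff, hres]; split_ifs with h <;> simp [h]
      rw [coeff_gf_mul_gf]
      have hset : ((B ×ˢ C).filter fun PS => ind PS.1 + ind PS.2 = m - ind T) = if T ∈ B ∧ T ∈ C then {(T, T)} else ∅ := by
        ext ⟨Q, R⟩
        simp only [mem_filter, mem_product, ind_add_ind_eq_iff, hdbl, hsupp]
        constructor
        · rintro ⟨⟨hQ, hR⟩, _, hI, hU⟩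
          have hQT : Q = T := Subset.antisymm (hU ▸ subset_union_left) (hI ▸ inter_subset_left)
          have hRT : R = T := Subset.antisymm (hU ▸ subset_union_right) (hI ▸ inter_subset_right)
          subst hQT; subst hRT
          rw [if_pos ⟨hQ, hR⟩]; exact mem_singleton_self _
        · intro h
          split_ifs at h with hBC
          · rw [mem_singleton] at h; cases h
            refine ⟨hBC, fun v => ?_, inter_self _, union_self _⟩
            rw [hres]; split_ifs <;> omega
          · exact absurd h (notMem_empty _)
      rw [hset]
      by_cases hBC : T ∈ B ∧ T ∈ C
      · rw [if_pos hBC, card_singleton, if_pos ⟨hpure, hTA, hBC⟩]; rfl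
      · rw [if_neg hBC, card_empty, if_neg (fun h => hBC h.2.2)]; rfl
    · rw [if_neg (fun h => hTA h.2.1)]
      exact sum_eq_zero fun S hS => hvan S hS (Or.inl fun h => hTA (h ▸ (mem_filter.1 hS).1))
  · rw [if_neg (fun h => hpure h.1)]
    exact sum_eq_zero fun S hS => hvan S hS (Or.inr hpure)

/-- **Pure profiles carry no coefficient of `R_D`**: if every entry of `m` lies in `{0} ∪ [3,∞)` then `coeff_m R_D(𝒳,𝒵) = 0` (all three triple products
see only the diagonal triple `(T,T,T)`, and `[T∈D]·(1−[T∈D]) − [T∈D] + [T∈D] = 0`). [this work] -/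
theorem coeff_Rlump_eq_zero_of_pure (D F G : Finset (Finset α)) {m : α →₀ ℕ} (hm : ∀ v, m v = 0 ∨ 3 ≤ m v) :
    (Rlump D F G).coeff m = 0 := by
  unfold Rlump PiP
  rw [mul_sub, coeff_add, coeff_sub, coeff_gf3_of_pure _ _ _ hm, coeff_gf3_of_pure _ _ _ hm, coeff_gf3_of_pure _ _ _ hm]
  simp only [mem_filter, mem_inter, mem_powerset, subset_univ, true_and]
  by_cases hp : ∀ v, m v = 0 ∨ m v = 3 <;> by_cases hD : m.support ∈ D <;> by_cases hF : m.support ∈ F <;>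
    by_cases hG : m.support ∈ G <;> simp [hp, hD, hF, hG]

/-! ### One-vertex monotonicity ⇒ nonnegativity -/

/-- The mixed vertices of a profile (entries `1` or `2`). [this work] -/
def mixedVerts (m : α →₀ ℕ) : Finset α := m.support.filter fun v => m v = 1 ∨ m v = 2

omit [Fintype α] in
/-- Lowering an entry `1` to `0` removes that vertex from the mixed set. [this work] -/
theorem mixedVerts_tsub_single {m : α →₀ ℕ} {v : α} (hv : m v = 1) :
    mixedVerts (m - Finsupp.single v 1) = (mixedVerts m).erase v := by
  ext w
  simp only [mixedVerts, mem_filter, mem_erase, Finsupp.mem_support_iff, Finsupp.tsub_apply, Finsupp.single_apply]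
  by_cases h : v = w
  · subst h; simp [hv]
  · simp [h, Ne.symm h]

omit [Fintype α] in
/-- Raising an entry `2` to `3` removes that vertex from the mixed set. [this work] -/
theorem mixedVerts_add_single {m : α →₀ ℕ} {v : α} (hv : m v = 2) :
    mixedVerts (m + Finsupp.single v 1) = (mixedVerts m).erase v := by
  ext w
  simp only [mixedVerts, mem_filter, mem_erase, Finsupp.mem_support_iff, Finsupp.add_apply, Finsupp.single_apply]
  by_cases h : v = w
  · subst h; simp [hv]
  · simp [h, Ne.symm h]

omit [Fintype α] in
/-- **One-vertex monotonicity implies nonnegativity**: a function of profiles vanishing at every profile with entries in `{0} ∪ [3,∞)`, non-decreasing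
under raising an entry `0 → 1` (C1) and non-increasing under raising `2 → 3` (C2), is nonnegative everywhere (induction on the number of entries in
`{1,2}`; memo g27 §4.1). [this work] -/
theorem coeff_nonneg_of_oneVertex_monotone (c : (α →₀ ℕ) → ℤ) (h0 : ∀ m : α →₀ ℕ, (∀ v, m v = 0 ∨ 3 ≤ m v) → c m = 0)
    (hC1 : ∀ (m : α →₀ ℕ) (v : α), m v = 1 → c (m - Finsupp.single v 1) ≤ c m)
    (hC2 : ∀ (m : α →₀ ℕ) (v : α), m v = 2 → c (m + Finsupp.single v 1) ≤ c m) (m : α →₀ ℕ) : 0 ≤ c m := by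
  suffices h : ∀ k, ∀ m : α →₀ ℕ, #(mixedVerts m) = k → 0 ≤ c m from h _ m rfl
  intro k
  induction k with
  | zero =>
    intro m hm
    rw [h0 m fun v => ?_]
    have hv : v ∉ mixedVerts m := by rw [card_eq_zero.1 hm]; exact notMem_empty v
    simp only [mixedVerts, mem_filter, Finsupp.mem_support_iff, not_and, not_or] at hv
    by_cases h : m v = 0
    · exact Or.inl h
    · have := hv h; omega
  | succ k ih =>
    intro m hm
    obtain ⟨v, hv⟩ : (mixedVerts m).Nonempty := card_pos.1 (by omega)
    have hv' := (mem_filter.1 hv).2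
    rcases hv' with h1 | h2
    · refine le_trans (ih _ ?_) (hC1 m v h1)
      rw [mixedVerts_tsub_single h1, card_erase_of_mem hv, hm]; rfl
    · refine le_trans (ih _ ?_) (hC2 m v h2)
      rw [mixedVerts_add_single h2, card_erase_of_mem hv, hm]; rfl

/-- **REDUCTION (memo g27 §4.1–4.3)**: if the coefficients `c(m) = coeff_m R_D(𝒳,𝒵)` satisfy the one-vertex monotonicities
C1 (`c(m − e_v) ≤ c(m)` whenever `m_v = 1`) and C2 (`c(m + e_v) ≤ c(m)` whenever `m_v = 2`), then `R_D(𝒳,𝒵) ∈ ℕ[s]` — for any lumped family `D` and any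
pair (no up-set hypothesis is needed for this step).  For `D = {N<t}` C1/C2 are the conjectures of memo g27 §4 (0 failures k ≤ 10); C2 ⇒ C1 for down-sets. [this work] -/
theorem coeff_Rlump_nonneg_of_C1_C2 (D F G : Finset (Finset α))
    (hC1 : ∀ (m : α →₀ ℕ) (v : α), m v = 1 → (Rlump D F G).coeff (m - Finsupp.single v 1) ≤ (Rlump D F G).coeff m)
    (hC2 : ∀ (m : α →₀ ℕ) (v : α), m v = 2 → (Rlump D F G).coeff (m + Finsupp.single v 1) ≤ (Rlump D F G).coeff m) (m : α →₀ ℕ) :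
    0 ≤ (Rlump D F G).coeff m :=
  coeff_nonneg_of_oneVertex_monotone (fun m => (Rlump D F G).coeff m) (fun _ hm => coeff_Rlump_eq_zero_of_pure D F G hm) hC1 hC2 m

end Summit.CriticalPhenomena.PercolationContinuityZ3.Theorems.SahiCTCForms
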